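import Mathlib
import Summits.MatrixMultiplication.MatrixMultiplication.Theorems.LieRankDesigns.Negative.Basics
import Summits.MatrixMultiplication.MatrixMultiplication.Theorems.LevelGradedCohnUmansLieRankDesignsStubEvalCriterion
import Summits.MatrixMultiplication.MatrixMultiplication.Theorems.LevelGradedCohnUmansLieRankDesignsStubOracleSound
import Summits.MatrixMultiplication.MatrixMultiplication.Theorems.LevelGradedCohnUmansLieRankDesignsStubLevelOneBudget
import HarnessLib.Audit

/-!
# Line `fixed-rank-universality-gl2-level-one` — crux `LevelGradedCohnUmans.LieRankDesigns`
(stmt-MatrixMultiplication-7614)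

LEAD SKELETON v1 (lead seat prover-line-stmt-MatrixMultiplication-7614-c1-0, 2026-08-16; PICKED.md) = the
CRUX-PLAN SKELETON (planner-cruxplan-stmt-MatrixMultiplication-7614-fixed-rank-universal-0, 2026-08-16), built
from the triage-passed card `Cruxes/LieRankDesigns/Ideas/fixed-rank-universality-gl2-level-one.md` (ideator 2;
triage r1-1/r1-2/r1-3: pass ×3) and its sharpenings, taken over unchanged: stubs A, B, C fanned out to workers
(wave 1: A p98012, B p98474, C p99160 — all ACCEPTED 2026-08-16 and imported below; the three `stub_*`
theorems here are now one-line aliases of the landed `Theorems.LieRankDesigns.stub_*`), D held by the lead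
(the only `sorry` left).

CRUX (by name): `Summit.MatrixMultiplication.MatrixMultiplication.Theses.LevelGradedCohnUmans.LieRankDesigns` —
`∀ ε > 0 ∃ p prime, m, k, X Y Z ⊆ GL_m(𝔽_p)`, rank-`≤ k`-separated, with
`budget p m k (2+ε) < volume X Y Z ^ ((2+ε)/3)` (vocabulary of `Theorems/LieRankDesigns/Negative/Basics.lean`;
`lieRankDesigns_iff` is `Iff.rfl`).

THE LINE — LEVEL ONE AT A FIXED RANK `m`, `p → ∞` (the card's lever "universality of a fixed cell" in its
"General form", run where the triage told the lead to run it: cells `(m, 1)`, `m ≥ 3` first; `(2, 1)` is the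
sibling crux `LevelOneGL2Designs` = stmt-14080 and is treated as a disprover target, TRIAGE-r1-2).
At level `k = 1` the graded budget of `GL_m(𝔽_p)` is carried by `N_eff = p - 1` Harish-Chandra twists `π(θ,1)` of
EQUAL degree `(p^m-1)/(p-1)`, so `budget_s ≍ p^{(m-1)s+1}` while the wall is `D_1 ≍ p^{2m-1}`: constant-factor
saturation of the three level-one walls at ONE rank `m` along unboundedly many primes proves the crux for EVERY
`ε` (`V^{s/3}/budget_s ≍ c^s p^{s/2-1} → ∞`).  The level-one test space is explicit — functions of ONE
matrix–vector product, `f(g) = Σ_u Φ(u, g u)`, i.e. the matrix coefficients of the permutation representation of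
`GL_m(𝔽_p)` on `ℂ[𝔽_p^m]` — so separation is decided by the EXACT LINEAR ORACLE: linear (in)dependence of the
permutation matrices `π(g) = ([g u = v])_{v,u}` of the quadruple products.  The skeleton is

  `EvalCriterion` (A) → `OracleSound` (B) → `LevelOneBudget` (C) → `LevelOnePacking` (D) → `LieRankDesigns`,

with the universality transfer PROVED below (`lieRankDesigns_of_budget_of_saturation`, pure `rpow` bookkeeping,
ported at `k = 1` from the lead's `Lines/Sketch.lean` `lieRankDesigns_of_cellBudget_of_nearWall` /
`nearWallDesigns_of_fixedCell`).

Stubs (registered; A, B, C LANDED p98012/p98474/p99160; D open = the bet):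
* A `stub_evalCriterion` (M) — abstract duality: for a finite type `G`, a subspace `J ≤ ℂ^G`, a family of
  "target" points `t : ι → G` and a set `S` of "garbage" points, if the evaluation functionals `ev_{t i}|_J` are
  linearly independent and their span meets `span{ev_s|_J : s ∈ S}` trivially, then every `t i` is cut out by
  some `f ∈ J` (`f(t i) = 1`, `f = 0` on the other `t j` and on `S`).  (Sufficiency half of TRIAGE-r1-2 App. B;
  the necessity half is the tree's `card_add_card_le_finrank`.)  [finite-dimensional duality, `Module.evalEquiv`]
* B `stub_oracleSound` (M) — A ⇒ soundness of the level-one oracle: if the permutation matrices of the pair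
  products `x⁻¹z` (indexed by `(x,z) ∈ X × Z`) are linearly independent and their span is disjoint from the span
  of the permutation matrices of the middle products `x⁻¹yy'⁻¹z`, `y ≠ y'`, then `RankSep 1 X Y Z`.  Dictionary:
  every matrix entry `g ↦ [g u = v]` is a level-one function (landed `Theorems.LieRankDesigns.stub_frameFnLevel` at
  `k = 1`, `φ` an indicator), so a linear relation among the `ev_g|_{F_1}` is a relation among the `π(g)`; the two
  oracle conditions also encode the TPP (equal group elements have equal matrices).
* C `stub_levelOneBudget` (S/M) — the level-one cell budget for every `m ≥ 1`, `s ≥ 2`: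
  `budget p m 1 s · (p-1)^{(s-2)/2} ≤ 2^{m(s-1)} p^{(m-1/2)s}`.  This is the `k = 1` slice of the lead's
  `CellBudget`, LANDED in substance (stubs A–F of line `Sketch`: p87876, p89272, p89717, p90134, p90736, p91913;
  `stub_budgetGlue … p m 1`); it is a stub here only because the farm has not rebuilt those modules
  (`remote:stale … unbuilt`, 2026-08-16T09:50Z) — closing it is one `simpa` once they are served.
* D `stub_levelOnePacking` (XL, OPEN — hardest; the crux's content at level one, in oracle form): some rank
  `m ≥ 2`, a constant `c > 0` and, for unboundedly many primes `p`, sets `X, Y, Z ⊆ GL_m(𝔽_p)` of sizes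
  `≥ c·p^{m-1/2}` passing the oracle (pair matrices independent, middle span transversal).

DISPROOF USED (`Cruxes/LieRankDesigns/Disproof.lean`, cdisprove v1, verdict NO KILL; landed `Negative/Basics.lean`):
there is no `_false_without_<H>` theorem for this crux; the line honours every load-bearing finding: it concludes
`RankSep` VERBATIM through B and keeps the strict `<` (`lieRankDesigns_le_variant`, `one_le_budget`,
`two_le_volume`); the dead slices are never instantiated — `k = 1 ≥ 1` (`not_lieRankDesigns_levelZero`), D demands
`m ≥ 2` (`not_lieRankDesigns_rankZeroMatrices`, `not_lieRankDesigns_matOne`); the walls `|X||Y|,|X||Z|,|Y||Z| ≤ N_1`,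
the graded Neumann cap `V ≤ 0.385 N_1^{3/2}` (so `c ≤ 0.73` per set, and `c < 1/√2` at `m = 2` by the sibling's
`ConstantWindow`), the pigeonhole `|X||Y| + |Y||Z| ≤ |G|` and — new at level one for `m ≥ 3` (`2k < m`, `p` odd) —
the ISOTROPY bound `|X||Z| + |X⁻¹YY⁻¹Z| ≤ |G|` (`card_XZ_add_card_quadProducts_le`) are consequences of `RankSep`
and constrain only D's witnesses (recorded in D's docstring).  Landed Negative lemmas checked against D: at `m = 2`
every permutable-subgroup architecture (`LevelOneGL2Designs.Negative.PermutableGL2/PermutableSubgroups`: `V ≤ N_1`),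
every torus-rectangle configuration (`Rectangle.not_rankSep_of_torus_rectangle`) and `c ≥ 1/√2` (`ConstantWindow`)
are excluded; `SubgroupIdentityDesigns.Negative.GradedNormalizerCount` excludes subgroup triples with a normalising
member at every `m`.  D is existential over `m` and architecture-free, so it is an instance of none of them; its
`m = 2` slice is crux 14080 (open; any `O(p⁴)` level-one packing bound kills that slice — `Milestone.lean` — not D).
Negatives index (`ledger negatives`): unrelated (AlgebraicSTPPDichotomy, DesignFlattening, …).
-/

set_option linter.dupNamespace false

noncomputable section

namespace Summit.MatrixMultiplication.MatrixMultiplication.Cruxes.LieRankDesigns.FixedRankUniversalityGl2LevelOne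

open scoped BigOperators
open Literature.RepresentationTheory.FiniteGroups
open Summit.MatrixMultiplication.MatrixMultiplication.Theorems.LieRankDesigns.Negative
  (GLm Mat fourierFn RankSupp RankSep levelSet budget volume lieRankDesigns_iff)

/-! ## Level-one vocabulary (local names; the registered stubs below spell everything out) -/

/-- Evaluation at `g`, restricted to a subspace `J` of functions `G → ℂ`, as a linear functional on `J`. -/
def evalAt {G : Type} (J : Submodule ℂ (G → ℂ)) (g : G) : Module.Dual ℂ J :=
  (LinearMap.proj g).comp J.subtype

/-- The permutation matrix of `g ∈ GL_m(𝔽_p)` on column vectors: entry `(v, u)` is `[g u = v]`.  The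
level-one test space `F_1` is exactly the span of its entries `g ↦ π(g)_{v,u}` (frame duality at `k = 1`), so
`F_1`-separation is linear algebra on these matrices — the "exact linear oracle" of the card. -/
def permMat {p m : ℕ} (g : GLm p m) : Matrix (Fin m → ZMod p) (Fin m → ZMod p) ℂ :=
  fun v u => if (g : Mat p m).mulVec u = v then 1 else 0

/-- Index type of the pair products: `(x, z) ∈ X × Z`. -/
abbrev PairIdx {p m : ℕ} (X Z : Finset (GLm p m)) : Type :=
  {q : GLm p m × GLm p m // q.1 ∈ X ∧ q.2 ∈ Z}

/-- The family of pair-product matrices `π(x⁻¹z)`, indexed by the PAIR (so injectivity of `(x,z) ↦ x⁻¹z` is part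
of its linear independence). -/
def pairMat {p m : ℕ} (X Z : Finset (GLm p m)) :
    PairIdx X Z → Matrix (Fin m → ZMod p) (Fin m → ZMod p) ℂ :=
  fun q => permMat (q.1.1⁻¹ * q.1.2)

/-- The set of middle-product matrices `π(x⁻¹ y y'⁻¹ z)`, `y ≠ y'`. -/
def middleMats {p m : ℕ} (X Y Z : Finset (GLm p m)) : Set (Matrix (Fin m → ZMod p) (Fin m → ZMod p) ℂ) :=
  {A | ∃ x ∈ X, ∃ y ∈ Y, ∃ y' ∈ Y, ∃ z ∈ Z, y ≠ y' ∧ A = permMat (x⁻¹ * y * y'⁻¹ * z)}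

/-- ORACLE, condition (a): the pair matrices are linearly independent (as a family over `X × Z`). -/
def OracleIndependent {p m : ℕ} (X Z : Finset (GLm p m)) : Prop :=
  LinearIndependent ℂ (pairMat X Z)

/-- ORACLE, condition (b): the pair span and the middle span meet trivially. -/
def OracleTransversal {p m : ℕ} (X Y Z : Finset (GLm p m)) : Prop :=
  Disjoint (Submodule.span ℂ (Set.range (pairMat X Z))) (Submodule.span ℂ (middleMats X Y Z))

/-! ## A — the abstract evaluation criterion (size M) -/

/-- **A `EvalCriterion`.**  `G` a finite type, `J ≤ ℂ^G` a subspace, `t : ι → G` targets, `S ⊆ G` garbage.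
If `(ev_{t i}|_J)_i` is linearly independent in `J^*` and `span(ev_{t i}|_J) ∩ span(ev_s|_J : s ∈ S) = 0`,
then for every `i` there is `f ∈ J` with `f (t i) = 1`, `f (t j) = 0` (`j ≠ i`) and `f s = 0` (`s ∈ S`).
Proof: the functional `ev_{t i}` lies outside `W := span(ev_{t j}, j ≠ i) + span(ev_S)`, so some element of
`J^{**} ≅ J` (finite dimension, `Module.evalEquiv`) kills `W` and not `ev_{t i}`; rescale.
Why it might fail: it does not (finite-dimensional duality). [folklore; TRIAGE-r1-2 App. B] -/
def EvalCriterion : Prop :=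
  ∀ (G : Type) [Fintype G] (J : Submodule ℂ (G → ℂ)) (ι : Type) (t : ι → G) (S : Set G),
    LinearIndependent ℂ (fun i => evalAt J (t i)) →
    Disjoint (Submodule.span ℂ (Set.range fun i => evalAt J (t i))) (Submodule.span ℂ (evalAt J '' S)) →
    ∀ i : ι, ∃ f ∈ J, f (t i) = 1 ∧ (∀ j : ι, j ≠ i → f (t j) = 0) ∧ ∀ s ∈ S, f s = 0

/-- Registered stub A (statement = `EvalCriterion`, `evalAt` inlined). -/
theorem stub_evalCriterion :
    ∀ (G : Type) [Fintype G] (J : Submodule ℂ (G → ℂ)) (ι : Type) (t : ι → G) (S : Set G),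
      LinearIndependent ℂ (fun i => ((LinearMap.proj (t i)).comp J.subtype : Module.Dual ℂ J)) →
      Disjoint (Submodule.span ℂ (Set.range fun i => ((LinearMap.proj (t i)).comp J.subtype : Module.Dual ℂ J)))
        (Submodule.span ℂ ((fun g => ((LinearMap.proj g).comp J.subtype : Module.Dual ℂ J)) '' S)) →
      ∀ i : ι, ∃ f ∈ J, f (t i) = 1 ∧ (∀ j : ι, j ≠ i → f (t j) = 0) ∧ ∀ s ∈ S, f s = 0 :=
  Summit.MatrixMultiplication.MatrixMultiplication.Theorems.LieRankDesigns.stub_evalCriterion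

/-! ## B — soundness of the level-one oracle (size M) -/

/-- **B `OracleSound`** (the level-one dictionary).  For `X, Y, Z ⊆ GL_m(𝔽_p)`: if the permutation matrices
`π(x⁻¹z)` (on column vectors `𝔽_p^m`, indexed by `(x,z) ∈ X × Z`) are linearly independent and their span is
disjoint from the span of the `π(x⁻¹yy'⁻¹z)`, `y ≠ y'`, then `(X, Y, Z)` is rank-`≤ 1` separated.  Proof: with
`J := F_1|_G` as a submodule (closed under `+`, `•`: landed `add_mem_levelSet`/`smul_mem_levelSet`, or the sibling's
`levelSubmodule p m 1`), every matrix entry `g ↦ [g u = v] = π(g)_{v,u}` lies in `J` (landed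
`Theorems.LieRankDesigns.stub_frameFnLevel` at `k = 1` with `φ U W := [U = u]·[W = v]`, `U, W ∈ M_{m×1}`), so the
linear map `ℂ^G → Matrices`, `δ_g ↦ π(g)`, factors through `g ↦ ev_g|_J`; hence independence / span-disjointness of
the `π`'s imply the same for the `ev|_J`'s, and A (with `t (x,z) := x⁻¹z`, `S :=` middle products) gives, for the
target `(x₀, z₀)`, an `f = fourierFn c ∈ J`, `RankSupp 1 c`, with `f(x₀⁻¹z₀) = 1`, `f = 0` on the other pair
products and on all middle products — which is the `RankSep 1` clause (a quadruple with `y = y'` is a pair product;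
pair products of distinct pairs are distinct group elements, and no middle product equals `x₀⁻¹z₀`, both because
equal elements have equal — non-zero — matrices).  Why it might fail: it does not. [BlasiakCohnGrochowPrattUmans2024
Def 2.1; GurevichHowe2017 (rank-one modes)] -/
def OracleSound : Prop :=
  ∀ (p m : ℕ) [Fact p.Prime] (X Y Z : Finset (GLm p m)),
    OracleIndependent X Z → OracleTransversal X Y Z → RankSep 1 X Y Z

/-- Registered stub B (statement = `EvalCriterion → OracleSound`, everything inlined into Mathlib + `Basics`
vocabulary so that the landed helper can carry the identical signature without importing this file). -/
theorem stub_oracleSound :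
    (∀ (G : Type) [Fintype G] (J : Submodule ℂ (G → ℂ)) (ι : Type) (t : ι → G) (S : Set G),
      LinearIndependent ℂ (fun i => ((LinearMap.proj (t i)).comp J.subtype : Module.Dual ℂ J)) →
      Disjoint (Submodule.span ℂ (Set.range fun i => ((LinearMap.proj (t i)).comp J.subtype : Module.Dual ℂ J)))
        (Submodule.span ℂ ((fun g => ((LinearMap.proj g).comp J.subtype : Module.Dual ℂ J)) '' S)) →
      ∀ i : ι, ∃ f ∈ J, f (t i) = 1 ∧ (∀ j : ι, j ≠ i → f (t j) = 0) ∧ ∀ s ∈ S, f s = 0) →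
    ∀ (p m : ℕ) [Fact p.Prime] (X Y Z : Finset (GLm p m)),
      LinearIndependent ℂ (fun q : {q : GLm p m × GLm p m // q.1 ∈ X ∧ q.2 ∈ Z} =>
        fun v u : Fin m → ZMod p =>
          if ((q.1.1⁻¹ * q.1.2 : GLm p m) : Mat p m).mulVec u = v then (1 : ℂ) else 0) →
      Disjoint
        (Submodule.span ℂ (Set.range fun q : {q : GLm p m × GLm p m // q.1 ∈ X ∧ q.2 ∈ Z} =>
          fun v u : Fin m → ZMod p =>
            if ((q.1.1⁻¹ * q.1.2 : GLm p m) : Mat p m).mulVec u = v then (1 : ℂ) else 0))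
        (Submodule.span ℂ {A : Matrix (Fin m → ZMod p) (Fin m → ZMod p) ℂ |
          ∃ x ∈ X, ∃ y ∈ Y, ∃ y' ∈ Y, ∃ z ∈ Z, y ≠ y' ∧
            A = fun v u : Fin m → ZMod p =>
              if ((x⁻¹ * y * y'⁻¹ * z : GLm p m) : Mat p m).mulVec u = v then (1 : ℂ) else 0}) →
      RankSep 1 X Y Z :=
  Summit.MatrixMultiplication.MatrixMultiplication.Theorems.LieRankDesigns.stub_oracleSound

/-! ## C — the level-one cell budget (size S/M; the `k = 1` slice of the lead's landed `CellBudget`) -/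

/-- **C `LevelOneBudget`.**  For `p` prime, `m ≥ 1`, `s ≥ 2`:
`budget p m 1 s · (p-1)^{(s-2)/2} ≤ 2^{m(s-1)} · p^{(m-1/2)s}`.  True shape: `Irr ∩ F_1 = {1, ρ_{(m-1,1)}, π(θ,1)}`,
`budget_s = 1 + ((p^m-p)/(p-1))^s + (p-2)((p^m-1)/(p-1))^s ≍ p^{(m-1)s+1}`; the crude form (the centre's slack
`(p-1)^{-(s-2)/2}` in place of the Harish-Chandra `p^{-(s-2)/2}`, constant `2^{m(s-1)}`) is all the transfer needs.
Proof: `Theorems.LieRankDesigns.stub_budgetGlue stub_levelFixedVector stub_parabolicFacts stub_orbitSpanBound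
stub_regularCount stub_centralDegreeBound p m 1 le_rfl hm s hs` and `Nat.cast_one`/`ring_nf` on the exponent.
Why it might fail: it does not (landed in substance). [LevelGradedCohnUmansLieRankDesignsStubBudgetGlue.lean] -/
def LevelOneBudget : Prop :=
  ∀ (p m : ℕ) [Fact p.Prime], 1 ≤ m → ∀ s : ℝ, 2 ≤ s →
    budget p m 1 s * ((p : ℝ) - 1) ^ ((s - 2) / 2) ≤
      2 ^ ((m : ℝ) * (s - 1)) * (p : ℝ) ^ (((m : ℝ) - 1 / 2) * s)

/-- Registered stub C (statement = `LevelOneBudget`). -/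
theorem stub_levelOneBudget :
    ∀ (p m : ℕ) [Fact p.Prime], 1 ≤ m → ∀ s : ℝ, 2 ≤ s →
      budget p m 1 s * ((p : ℝ) - 1) ^ ((s - 2) / 2) ≤
        2 ^ ((m : ℝ) * (s - 1)) * (p : ℝ) ^ (((m : ℝ) - 1 / 2) * s) :=
  Summit.MatrixMultiplication.MatrixMultiplication.Theorems.LieRankDesigns.stub_levelOneBudget

/-! ## D — level-one packing in oracle form (the closer; size XL, OPEN) -/

/-- **D `LevelOnePacking`** (hardest stub — the crux's construction problem at level one, held by the lead).
There are a rank `m ≥ 2` and `c > 0` such that for unboundedly many primes `p` some `X, Y, Z ⊆ GL_m(𝔽_p)` with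
`|X|, |Y|, |Z| ≥ c · p^{m - 1/2}` (the level-one wall `D_1 ≍ p^{2m-1}` up to the constant `c²` on each pair) pass
the ORACLE: the pair matrices `π(x⁻¹z)` are linearly independent over `X × Z` and their span is disjoint from the
span of the middle matrices `π(x⁻¹yy'⁻¹z)`, `y ≠ y'` (`π(g)_{v,u} = [g u = v]` on `𝔽_p^m`).  By B this is
`RankSep 1` with the TPP built in; by C and the transfer below it proves the crux for every `ε`.
WHERE TO RUN IT (triage r1-2): `m ≥ 3` first — there `V ≍ p^{3m-3/2} = |G|^{(3m-3/2)/m²} < |G|` (`|G|^{0.83}` at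
`m = 3`), pieces of size `p^{m-1/2}` fit inside proper subgroups, and the TPP is FREE for `X ⊆ U_P`, `Y ⊆ L_P`,
`Z ⊆ U_P⁻` (unipotent radicals of two opposite parabolics and their common Levi factor — the Borel at `m = 3`,
type `(2, m-2)` from `m = 4` on, so that `|U_P| ≥ p^{m-1/2}`) by uniqueness of the `U_P L_P U_P⁻` factorisation
(`Q(X) Q(Y) Q(Z) ∋ q₁q₂q₃ = 1 ⇒ qᵢ = 1`); the whole difficulty is then level-one SEPARATION of thin (density
`p^{-1/2}`) subsets, decided by the oracle.  The `m = 2` slice is crux 14080 (`V ≍ |G|^{9/8}`, every architecture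
on record dead or `≤ p⁴`).
NECESSARY filters every witness meets (Disproof.lean + siblings): walls `|X||Y|,|X||Z|,|Y||Z| ≤ N_1 = #{rk ≤ 1}`,
graded Neumann `|X||Z| + |X|(|Y|-1) ≤ dim F_1` (so `c ≤ 0.62` on each pair; `c < 1/√2` at `m = 2`), pigeonhole,
ISOTROPY `|X||Z| + |X⁻¹YY⁻¹Z| ≤ |G|` for `m ≥ 3`, `p` odd; no permutable / normalising SUBGROUP triple
(`PermutableSubgroups`, `GradedNormalizerCount`: full `(U⁺, T, U⁻)`-type subgroup triples are charged their whole
volume, hence dead below the top level — thin subsets are not); no full torus rectangle of root-group cosets around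
a target (`Rectangle`, the `m = 2` ghost).  That ghost PERSISTS at every `m` for FULL cosets of the abelian radical
`U_col = {1 + w e_mᵀ : w ⊥ e_m}`: for `f ∈ F_1`, `u' ∈ {1 + e_m w'ᵀ}` fixed and `t = diag(t', t_m)` (`t' ∈ GL_{m-1}`),
`Σ_{u ∈ U_col} f(u t u') = A_f(t_m, u') + B_f(t', u')` is additively separable (Gauss sum in `w`), so the
`4 p^{m-1}` evaluations over `U_col · {corners of a (t', t_m)-rectangle} · u'` are linearly dependent — designs must
thin INSIDE radical cosets, never stack full ones.  Why it might fail: a LEVEL-ONE PACKING BARRIER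
`V = O(D_1·p^{m-1/2-η})` uniform in `m` — all blocks `π(θ,1)` of `F_1` share the monomial pattern of `g` on
`P^{m-1}(𝔽_p)`, the mechanism behind the conjectured `Θ(p³)` cap at `m = 2` (card, final datum; TRIAGE-r1-2) — would
kill D at every `m` at once; no level-one design beating even the graded sum of cubes is known at any `m`.
[CohnUmans2003 Prop 10–11; BlasiakCohnGrochowPrattUmans2024 Thm 2.2/3.3; BlasiakCohnGrochowPrattUmans2023 Thm 3.2;
GurevichHowe2017] -/
def LevelOnePacking : Prop :=
  ∃ m : ℕ, 2 ≤ m ∧ ∃ c : ℝ, 0 < c ∧ ∀ p₀ : ℕ, ∃ (p : ℕ) (_ : Fact p.Prime), p₀ ≤ p ∧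
    ∃ X Y Z : Finset (GLm p m), OracleIndependent X Z ∧ OracleTransversal X Y Z ∧
      c * (p : ℝ) ^ ((m : ℝ) - 1 / 2) ≤ X.card ∧ c * (p : ℝ) ^ ((m : ℝ) - 1 / 2) ≤ Y.card ∧
      c * (p : ℝ) ^ ((m : ℝ) - 1 / 2) ≤ Z.card

/-- Registered stub D (statement = `LevelOnePacking`, oracle conditions inlined). -/
theorem stub_levelOnePacking :
    ∃ m : ℕ, 2 ≤ m ∧ ∃ c : ℝ, 0 < c ∧ ∀ p₀ : ℕ, ∃ (p : ℕ) (_ : Fact p.Prime), p₀ ≤ p ∧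
      ∃ X Y Z : Finset (GLm p m),
        LinearIndependent ℂ (fun q : {q : GLm p m × GLm p m // q.1 ∈ X ∧ q.2 ∈ Z} =>
          fun v u : Fin m → ZMod p =>
            if ((q.1.1⁻¹ * q.1.2 : GLm p m) : Mat p m).mulVec u = v then (1 : ℂ) else 0) ∧
        Disjoint
          (Submodule.span ℂ (Set.range fun q : {q : GLm p m × GLm p m // q.1 ∈ X ∧ q.2 ∈ Z} =>
            fun v u : Fin m → ZMod p =>
              if ((q.1.1⁻¹ * q.1.2 : GLm p m) : Mat p m).mulVec u = v then (1 : ℂ) else 0))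
          (Submodule.span ℂ {A : Matrix (Fin m → ZMod p) (Fin m → ZMod p) ℂ |
            ∃ x ∈ X, ∃ y ∈ Y, ∃ y' ∈ Y, ∃ z ∈ Z, y ≠ y' ∧
              A = fun v u : Fin m → ZMod p =>
                if ((x⁻¹ * y * y'⁻¹ * z : GLm p m) : Mat p m).mulVec u = v then (1 : ℂ) else 0}) ∧
        c * (p : ℝ) ^ ((m : ℝ) - 1 / 2) ≤ X.card ∧ c * (p : ℝ) ^ ((m : ℝ) - 1 / 2) ≤ Y.card ∧
        c * (p : ℝ) ^ ((m : ℝ) - 1 / 2) ≤ Z.card := by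
  sorry

/-! ### Registered-stub aliases (hypothesis heads of `LieRankDesigns_of` are matched by short name) -/
namespace Registered

/-- Statement of registered stub A. -/
abbrev stub_evalCriterion : Prop := EvalCriterion
/-- Statement of registered stub B (`A → OracleSound`). -/
abbrev stub_oracleSound : Prop := EvalCriterion → OracleSound
/-- Statement of registered stub C. -/
abbrev stub_levelOneBudget : Prop := LevelOneBudget
/-- Statement of registered stub D (open; the closer). -/
abbrev stub_levelOnePacking : Prop := LevelOnePacking

end Registered

/-! ## The level-one universality transfer (PROVED): `OracleSound → LevelOnePacking → saturation`,
`LevelOneBudget → saturation → crux` -/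

/-- Level-one wall saturation up to a constant at one rank `m ≥ 1` (the `(m,1)` cell of the lead's
`FixedCellSaturation`, volume form). -/
def LevelOneSaturation : Prop :=
  ∃ m : ℕ, 1 ≤ m ∧ ∃ c₀ : ℝ, 0 < c₀ ∧ ∀ p₀ : ℕ, ∃ (p : ℕ) (_ : Fact p.Prime), p₀ ≤ p ∧
    ∃ X Y Z : Finset (GLm p m), RankSep 1 X Y Z ∧
      c₀ * (p : ℝ) ^ (3 * (m : ℝ) - 3 / 2) ≤ volume X Y Z

/-- **D ⇒ saturation** (through B): oracle-passing sets are `RankSep 1`, and three sets of size `≥ c p^{m-1/2}`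
have volume `≥ c³ p^{3m-3/2}`. -/
theorem levelOneSaturation_of (hB : OracleSound) (hD : LevelOnePacking) : LevelOneSaturation := by
  obtain ⟨m, hm, c, hc, hall⟩ := hD
  refine ⟨m, le_trans (by norm_num) hm, c ^ (3 : ℕ), by positivity, fun p₀ => ?_⟩
  obtain ⟨p, hprime, hp₀p, X, Y, Z, hind, hdisj, hX, hY, hZ⟩ := hall p₀
  refine ⟨p, hprime, hp₀p, X, Y, Z, hB p m X Y Z hind hdisj, ?_⟩
  have hp0 : (0 : ℝ) < p := by exact_mod_cast hprime.out.pos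
  set e : ℝ := (m : ℝ) - 1 / 2 with he_def
  have hce : 0 < c * (p : ℝ) ^ e := by positivity
  have hXpos : (0 : ℝ) < X.card := lt_of_lt_of_le hce hX
  have hYpos : (0 : ℝ) < Y.card := lt_of_lt_of_le hce hY
  have hV : (c * (p : ℝ) ^ e) ^ (3 : ℕ) ≤ volume X Y Z := by
    unfold volume
    push_cast
    have h := mul_le_mul (mul_le_mul hX hY hce.le hXpos.le) hZ hce.le (by positivity)
    nlinarith [h]
  have hpow : (c * (p : ℝ) ^ e) ^ (3 : ℕ) = c ^ (3 : ℕ) * (p : ℝ) ^ (3 * (m : ℝ) - 3 / 2) := by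
    rw [mul_pow, ← Real.rpow_natCast ((p : ℝ) ^ e) 3, ← Real.rpow_mul hp0.le]
    congr 1
    congr 1
    rw [he_def]; push_cast; ring
  rw [← hpow]
  exact hV

/-- **The transfer** (universality of the fixed rank `m` at level one; ε-bookkeeping only).  With `s = 2+ε`,
`e = m - 1/2`, C gives `budget ≤ 2^{m(s-1)} p^{es} (p-1)^{-ε/2} ≤ 2^{m(s-1)+ε/2} p^{es-ε/2}`, while saturation
(after absorbing the constant `c₀` into a loss `p^{-δ}`, `δ := 3ε/(8s)`) gives `V^{s/3} ≥ p^{es-ε/8}`; any prime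
with `p^{3ε/8} > 2^{m(s-1)+ε/2}` works.  Ported at `k = 1` from the lead's `Lines/Sketch.lean`
(`nearWallDesigns_of_fixedCell`, `lieRankDesigns_of_cellBudget_of_nearWall`). -/
theorem lieRankDesigns_of_budget_of_saturation (hC : LevelOneBudget) (hS : LevelOneSaturation) :
    (∀ ε : ℝ, 0 < ε → ∃ (p : ℕ) (_ : Fact p.Prime) (m k : ℕ) (X Y Z : Finset (GLm p m)),
      RankSep k X Y Z ∧ budget p m k (2 + ε) < volume X Y Z ^ ((2 + ε) / 3)) := by
  intro ε hε
  obtain ⟨m, hm, c₀, hc₀, hall⟩ := hS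
  set s : ℝ := 2 + ε with hs_def
  have hs2 : 2 ≤ s := by rw [hs_def]; linarith
  have hs0 : 0 < s := by linarith
  -- loss rate δ := 3ε/(8s), so that δ s / 3 = ε / 8
  set δ : ℝ := 3 * ε / (8 * s) with hδ_def
  have hδ : 0 < δ := by rw [hδ_def]; positivity
  -- constant to beat: K := 2^{m(s-1) + ε/2}; need p^{3ε/8} > K, and c₀ p^δ > 1
  set K : ℝ := 2 ^ ((m : ℝ) * (s - 1) + ε / 2) with hK_def
  have hK : 0 < K := by rw [hK_def]; positivity
  have hexp0 : 0 < 3 * ε / 8 := by positivity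
  obtain ⟨N, hN⟩ := exists_nat_gt (K ^ (1 / (3 * ε / 8)) + (1 / c₀) ^ (1 / δ) + 2)
  obtain ⟨p, hprime, hNp, X, Y, Z, hsep, hvol⟩ := hall N
  refine ⟨p, hprime, m, 1, X, Y, Z, hsep, ?_⟩
  have hp2 : 2 ≤ p := hprime.out.two_le
  have hpR : (2 : ℝ) ≤ p := by exact_mod_cast hp2
  have hp0 : (0 : ℝ) < p := by linarith
  have hq0 : (0 : ℝ) < (p : ℝ) - 1 := by linarith
  have hNR : (N : ℝ) ≤ p := by exact_mod_cast hNp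
  have hKroot : (0 : ℝ) ≤ K ^ (1 / (3 * ε / 8)) := by positivity
  have hcroot : (0 : ℝ) ≤ (1 / c₀) ^ (1 / δ) := by positivity
  -- K < p^{3ε/8}
  have hKp : K < (p : ℝ) ^ (3 * ε / 8) := by
    have h1 : K ^ (1 / (3 * ε / 8)) < p := by linarith
    have h2 : (K ^ (1 / (3 * ε / 8))) ^ (3 * ε / 8) < (p : ℝ) ^ (3 * ε / 8) :=
      Real.rpow_lt_rpow (by positivity) h1 hexp0
    have h3 : (K ^ (1 / (3 * ε / 8))) ^ (3 * ε / 8) = K := by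
      rw [← Real.rpow_mul hK.le]
      have : (1 / (3 * ε / 8)) * (3 * ε / 8) = 1 := by field_simp
      rw [this, Real.rpow_one]
    rwa [h3] at h2
  -- 1 < c₀ p^δ
  have hcp : 1 < c₀ * (p : ℝ) ^ δ := by
    have h1 : (1 / c₀) ^ (1 / δ) < p := by linarith
    have h2 : 1 / c₀ < (p : ℝ) ^ δ := by
      have h := Real.rpow_lt_rpow (by positivity) h1 hδ
      rwa [← Real.rpow_mul (by positivity), show (1 / δ) * δ = 1 by field_simp, Real.rpow_one] at h
    rw [div_lt_iff₀ hc₀] at h2; linarith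
  -- budget side
  set e : ℝ := (m : ℝ) - 1 / 2 with he_def
  have hbud := hC p m hm s hs2
  have hexp : (s - 2) / 2 = ε / 2 := by rw [hs_def]; ring
  rw [hexp] at hbud
  have hqpow : 0 < ((p : ℝ) - 1) ^ (ε / 2) := Real.rpow_pos_of_pos hq0 _
  have hbud' : budget p m 1 s ≤ 2 ^ ((m : ℝ) * (s - 1)) * (p : ℝ) ^ (e * s) / ((p : ℝ) - 1) ^ (ε / 2) := by
    rw [le_div_iff₀ hqpow]; exact hbud
  -- (p-1)^{ε/2} ≥ p^{ε/2} / 2^{ε/2}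
  have hhalf : (p : ℝ) / 2 ≤ (p : ℝ) - 1 := by linarith
  have hq1 : (p : ℝ) ^ (ε / 2) / 2 ^ (ε / 2) ≤ ((p : ℝ) - 1) ^ (ε / 2) := by
    rw [← Real.div_rpow hp0.le (by norm_num : (0:ℝ) ≤ 2)]
    exact Real.rpow_le_rpow (by positivity) hhalf (by positivity)
  have hpe2 : 0 < (p : ℝ) ^ (ε / 2) / 2 ^ (ε / 2) := by positivity
  have hbud'' : budget p m 1 s ≤ K * (p : ℝ) ^ (e * s - ε / 2) := by
    calc budget p m 1 s ≤ 2 ^ ((m : ℝ) * (s - 1)) * (p : ℝ) ^ (e * s) / ((p : ℝ) - 1) ^ (ε / 2) := hbud'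
      _ ≤ 2 ^ ((m : ℝ) * (s - 1)) * (p : ℝ) ^ (e * s) / ((p : ℝ) ^ (ε / 2) / 2 ^ (ε / 2)) :=
          div_le_div_of_nonneg_left (by positivity) hpe2 hq1
      _ = K * (p : ℝ) ^ (e * s - ε / 2) := by
          rw [hK_def, Real.rpow_add (by norm_num : (0:ℝ) < 2), Real.rpow_sub hp0]
          field_simp
  -- volume side: V ≥ c₀ p^{3e} ≥ p^{3e - δ}, so V^{s/3} ≥ p^{es - ε/8}
  have hV3 : 3 * (m : ℝ) - 3 / 2 = 3 * e := by rw [he_def]; ring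
  rw [hV3] at hvol
  have hsplit : (p : ℝ) ^ (3 * e - δ) * (p : ℝ) ^ δ = (p : ℝ) ^ (3 * e) := by
    rw [← Real.rpow_add hp0]; congr 1; ring
  have hq : 0 < (p : ℝ) ^ (3 * e - δ) := Real.rpow_pos_of_pos hp0 _
  have hvol' : (p : ℝ) ^ (3 * e - δ) ≤ volume X Y Z := by
    refine le_trans ?_ hvol
    calc (p : ℝ) ^ (3 * e - δ)
        = (p : ℝ) ^ (3 * e - δ) * 1 := by ring
      _ ≤ (p : ℝ) ^ (3 * e - δ) * (c₀ * (p : ℝ) ^ δ) := mul_le_mul_of_nonneg_left hcp.le hq.le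
      _ = c₀ * (p : ℝ) ^ (3 * e) := by rw [← hsplit]; ring
  have hV0 : 0 ≤ volume X Y Z := by unfold volume; positivity
  have hlow : ((p : ℝ) ^ (3 * e - δ)) ^ (s / 3) ≤ volume X Y Z ^ (s / 3) :=
    Real.rpow_le_rpow (by positivity) hvol' (by positivity)
  have hδs : (3 * e - δ) * (s / 3) = e * s - ε / 8 := by
    rw [hδ_def]; field_simp
  have hlow' : ((p : ℝ) ^ (3 * e - δ)) ^ (s / 3) = (p : ℝ) ^ (e * s - ε / 8) := by
    rw [← Real.rpow_mul hp0.le, hδs]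
  -- compare: K p^{es - ε/2} < p^{3ε/8} p^{es - ε/2} = p^{es - ε/8}
  have hmid : K * (p : ℝ) ^ (e * s - ε / 2) < (p : ℝ) ^ (e * s - ε / 8) := by
    have hpos : 0 < (p : ℝ) ^ (e * s - ε / 2) := Real.rpow_pos_of_pos hp0 _
    calc K * (p : ℝ) ^ (e * s - ε / 2)
        < (p : ℝ) ^ (3 * ε / 8) * (p : ℝ) ^ (e * s - ε / 2) := mul_lt_mul_of_pos_right hKp hpos
      _ = (p : ℝ) ^ (e * s - ε / 8) := by
          rw [← Real.rpow_add hp0]; congr 1; ring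
  have hdiv : (2 + ε) / 3 = s / 3 := by rw [hs_def]
  rw [hdiv]
  calc budget p m 1 s ≤ K * (p : ℝ) ^ (e * s - ε / 2) := hbud''
    _ < (p : ℝ) ^ (e * s - ε / 8) := hmid
    _ = ((p : ℝ) ^ (3 * e - δ)) ^ (s / 3) := hlow'.symm
    _ ≤ volume X Y Z ^ (s / 3) := hlow

/-- **THE SKELETON closes the crux modulo the ONE remaining registered stub D, BY NAME** (A, B, C are the landed
theorems `Theorems.LieRankDesigns.stub_evalCriterion` p98012, `stub_oracleSound` p98474, `stub_levelOneBudget` p99160,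
used here through the local aliases `stub_evalCriterion`, `stub_oracleSound`, `stub_levelOneBudget`). -/
theorem LieRankDesigns_of (hD : Registered.stub_levelOnePacking) :
    Summit.MatrixMultiplication.MatrixMultiplication.Theses.LevelGradedCohnUmans.LieRankDesigns :=
  lieRankDesigns_iff.2
    (lieRankDesigns_of_budget_of_saturation stub_levelOneBudget
      (levelOneSaturation_of (stub_oracleSound stub_evalCriterion) hD))

/-- How the closed proof is obtained once D lands (the inlined registered signature matches the `Registered`
alias definitionally). -/
example : Summit.MatrixMultiplication.MatrixMultiplication.Theses.LevelGradedCohnUmans.LieRankDesigns :=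
  LieRankDesigns_of stub_levelOnePacking

end Summit.MatrixMultiplication.MatrixMultiplication.Cruxes.LieRankDesigns.FixedRankUniversalityGl2LevelOne

end
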